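import Summits.ResolutionOfSingularities.ResolutionOfSingularities.Theorems.FrobeniusLadderFRationalResolutionConeChartNextRound
import Summits.ResolutionOfSingularities.ResolutionOfSingularities.Theorems.FrobeniusLadderFRationalResolutionFixedStratumVertexSingular
import HarnessLib

/-!
# Crux `FrobeniusLadder.FRationalResolution` (stmt-ResolutionOfSingularities-15317), line `redirect`,
# stub `stub_diagonalizableQuotientResolution` — **the recursion step packaged over a log stratum of ANY dimension**
# (design C3 = the rank-2 stratum layer of the non-isolated case, memo MEMO-15317-leafhand2-g10 §2 (L2):
# `…ConeChartNextRound.exists_fixedPrime_package` with its zero-dimensional-stratum hypotheses `h0`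
# (`𝔪_{A_𝔭} = I(𝔭)A_𝔭`) and `hdimA` (`dim A_𝔭 ≤ 2`) REPLACED by log regularity of the base chart along the stratum of
# `𝔭` and the rank bound `n − rk F_𝔭 ≤ 2`; every other clause and its proof is lineage 2's, verbatim)

DATA: the invariant of memo MEMO-15317-leafhand2-g8 §2 — base `(A, P, φ, 𝔭)` log regular at `𝔭` AND at the primes
`𝔮 ⊆ 𝔭` of the stratum of `𝔭` (`I(𝔭, φ) ⊆ 𝔮`), `P` finitely generated, saturated, spanning, `n − rk F_𝔭 ≤ 2` (a rank-2
stratum of any dimension `d = dim A_𝔭 − 2`), chart algebra `(C, Q, χ)` over it ((χ), (gen), (D), (K), (Ω), `Q.FG`), a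
finite `s ⊆ Q`, `h ∈ s`, and a vertex description `(v, x, c)`, `c ≥ 2`, of the chart monoid `Q_h` (output of
`…ConeChainCharts.round_charts`). RESULTS:
* `not_isRegularLocalRing_chart_fixedPrime_of_stratum` — on `C_h = C[(χ s)/χ(h)]` every prime over `𝔭` containing
  `χ_h(Q_h ∖ ℤF_𝔭)` is SINGULAR (`…FixedStratumVertexSingular`);
* **`exists_fixedPrime_package_of_stratum`** — the fixed prime `𝔓_h` of `C_h` over `𝔭` exists, lies over any prime
  of `C` over `𝔭` containing `χ(Q ∖ ℤF_𝔭)`, `(C_h)_{𝔓_h}` is NOT regular, every other prime of `C_h` over `𝔭` is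
  regular, and `(C_h, Q_h, χ_h)` is a chart algebra over `(A, P, φ)` whose monoid is the cone in normal form
  `ℤF_𝔭 + {m x + l (v − x) : l ≥ 0, (c − 1) l ≤ c m}` — the invariant with measure `c`, now along a
  positive-dimensional stratum. Since the hypotheses are stable under passing to a stratum prime `𝔮 ⊆ 𝔭` (same
  unit face, `…FixedStratumChains.faceMonoid_eq_of_le_of_ideal_le`), the package applies at EVERY point of the
  stratum: the singular locus of the blown-up chart over the stratum is the union of the fixed strata of the
  charts with `c ≥ 2`.

Honest label: assembly toward ONE leaf stub (no stub, crux or summit closed). No definitions, no named facts, no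
sorry. [cite: Kato1994, (6.1), (7.3), (10.1), (10.3)] [cite: Niziol2006, §4] [cite: Matsumura1987, Thm. 19.3]
-/

noncomputable section

-- single-problem summit: the doubled namespace component is forced
set_option linter.dupNamespace false

open IsLocalRing Literature.AlgebraicGeometry.Resolution Literature.AlgebraicGeometry.Resolution.LogChart
open Summit.ResolutionOfSingularities.ResolutionOfSingularities.Theorems.FRationalResolution.ChartAlgebraFixedPoint
open Summit.ResolutionOfSingularities.ResolutionOfSingularities.Theorems.FRationalResolution.ChartAlgebraTower
open Summit.ResolutionOfSingularities.ResolutionOfSingularities.Theorems.FRationalResolution.VertexChartMonoid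
open Summit.ResolutionOfSingularities.ResolutionOfSingularities.Theorems.FRationalResolution.VertexChartBlowupCharts
open Summit.ResolutionOfSingularities.ResolutionOfSingularities.Theorems.FRationalResolution.ConeChainCharts
open Summit.ResolutionOfSingularities.ResolutionOfSingularities.Theorems.FRationalResolution.FixedStratumVertexSingular

namespace Summit.ResolutionOfSingularities.ResolutionOfSingularities.Theorems.FRationalResolution.FixedStratumNextRound

universe u

variable {A : Type u} [CommRing A] [IsNoetherianRing A] {n : ℕ} {P : AddSubmonoid (Fin n → ℤ)}
  {φ : Multiplicative P →* A} {𝔭 : Ideal A} [𝔭.IsPrime] {C : Type u} [CommRing C] [Algebra A C]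
  [IsNoetherianRing C] {Q : AddSubmonoid (Fin n → ℤ)} {χ : Multiplicative Q →* C}
  {s : Set (Fin n → ℤ)} {h v x : Fin n → ℤ} {c : ℕ}

/-- **For parameter `c ≥ 2` every fixed-stratum prime of a chart of the round is singular** (stratum of any
dimension): on `C_h` each prime over `𝔭` containing all `χ_h(q)`, `q ∉ L`, is not regular.
[cite: Kato1994, (6.1), (7.3), (10.1)] [cite: Matsumura1987, Thm. 19.3] -/
theorem not_isRegularLocalRing_chart_fixedPrime_of_stratum (hc : 2 ≤ c) (hs : s.Finite)
    (hP : P.FG) (hsat : ∀ (w : Fin n → ℤ) (k : ℕ), 0 < k → k • w ∈ P → w ∈ P)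
    (hreg : IsLogRegularAt P φ 𝔭)
    (hreg' : ∀ (𝔮 : Ideal A) [𝔮.IsPrime], 𝔮 ≤ 𝔭 → ideal P φ 𝔭 ≤ 𝔮 → IsLogRegularAt P φ 𝔮)
    (hrank : n - Module.finrank ℤ (Submodule.span ℤ (faceMonoid P φ 𝔭 : Set (Fin n → ℤ))) ≤ 2) (hPQ : P ≤ Q)
    (hχ : ∀ p : P, χ (Multiplicative.ofAdd ⟨(p : Fin n → ℤ), hPQ p.2⟩) =
      algebraMap A C (φ (Multiplicative.ofAdd p)))
    (hgen : Algebra.adjoin A (Set.range χ) = ⊤)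
    (hD : ∀ q ∈ Q, ∃ p ∈ P, q + p ∈ P)
    (hK : ∀ a : A, algebraMap A C a = 0 → ∃ p : P, φ (Multiplicative.ofAdd p) * a = 0)
    (hΩ : ∀ (K : Type u) [Field K] (g : A →+* K), (∀ p : P, g (φ (Multiplicative.ofAdd p)) ≠ 0) →
      ∃ ω : C →+* K, ω.comp (algebraMap A C) = g)
    (hQfg : Q.FG) (hhQ : h ∈ Q)
    (hQh : ∀ w, w ∈ blowupChartMonoid Q {q : Q | (q : Fin n → ℤ) ∈ s} ⟨h, hhQ⟩ ↔
      ∃ g ∈ Submodule.span ℤ (faceMonoid P φ 𝔭 : Set (Fin n → ℤ)), ∃ m l : ℤ,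
        0 ≤ m ∧ 0 ≤ m + (c : ℤ) * l ∧ w = g + m • v + l • x)
    (hind : ∀ g ∈ Submodule.span ℤ (faceMonoid P φ 𝔭 : Set (Fin n → ℤ)), ∀ m l : ℤ,
      g + m • v + l • x = 0 → m = 0 ∧ l = 0)
    (hspan : ∀ w : Fin n → ℤ, ∃ g ∈ Submodule.span ℤ (faceMonoid P φ 𝔭 : Set (Fin n → ℤ)),
      ∃ m l : ℤ, w = g + m • v + l • x)
    {𝔔 : Ideal (blowupAlgebra (Ideal.span ((fun q : Q => χ (Multiplicative.ofAdd q)) ''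
        {q : Q | (q : Fin n → ℤ) ∈ s})) (χ (Multiplicative.ofAdd ⟨h, hhQ⟩)))} [𝔔.IsPrime]
    (h𝔔 : 𝔔.comap (algebraMap A _) = 𝔭)
    (hq : ∀ q : blowupChartMonoid Q {q : Q | (q : Fin n → ℤ) ∈ s} ⟨h, hhQ⟩,
      (q : Fin n → ℤ) ∉ Submodule.span ℤ (faceMonoid P φ 𝔭 : Set (Fin n → ℤ)) →
        blowupChart Q χ {q : Q | (q : Fin n → ℤ) ∈ s} ⟨h, hhQ⟩ (Multiplicative.ofAdd q) ∈ 𝔔) :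
    ¬ IsRegularLocalRing (Localization.AtPrime 𝔔) := by
  haveI : IsNoetherianRing (blowupAlgebra (Ideal.span ((fun q : Q => χ (Multiplicative.ofAdd q)) ''
      {q : Q | (q : Fin n → ℤ) ∈ s})) (χ (Multiplicative.ofAdd ⟨h, hhQ⟩))) :=
    isNoetherianRing_blowupAlgebra_of_isNoetherianRing _ _
  obtain ⟨hgen₂, hD₂, hK₂, -⟩ := tower_pack hPQ hχ hgen hD hK hΩ {q : Q | (q : Fin n → ℤ) ∈ s} ⟨h, hhQ⟩
  have hχ₂ := tower_chi hPQ hχ (le_blowupChartMonoid Q {q : Q | (q : Fin n → ℤ) ∈ s} ⟨h, hhQ⟩)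
    (blowupChart_of_mem Q χ {q : Q | (q : Fin n → ℤ) ∈ s} ⟨h, hhQ⟩)
  have hfg₂ : (blowupChartMonoid Q {q : Q | (q : Fin n → ℤ) ∈ s} ⟨h, hhQ⟩).FG :=
    blowupChartMonoid_fg hQfg (preimage_finite hs) ⟨h, hhQ⟩
  exact not_isRegularLocalRing_fixedPrime_of_two_le_of_stratum hc hP hsat hreg hreg' hrank
    (hPQ.trans (le_blowupChartMonoid Q {q : Q | (q : Fin n → ℤ) ∈ s} ⟨h, hhQ⟩)) hχ₂ hgen₂ hD₂ hK₂ hfg₂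
    hQh hind hspan h𝔔 hq

/-- **The fixed prime of a chart of the round and the invariant with measure `c`, over a stratum of any
dimension.** `…ConeChartNextRound.exists_fixedPrime_package` with `h0`/`hdimA` replaced by `hreg'`/`hrank`.
[cite: Kato1994, (6.1), (7.3), (10.1), (10.3)] -/
theorem exists_fixedPrime_package_of_stratum (hc : 2 ≤ c) (hs : s.Finite) (hP : P.FG)
    (hsat : ∀ (w : Fin n → ℤ) (k : ℕ), 0 < k → k • w ∈ P → w ∈ P)
    (hspanP : Submodule.span ℤ (P : Set (Fin n → ℤ)) = ⊤) (hreg : IsLogRegularAt P φ 𝔭)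
    (hreg' : ∀ (𝔮 : Ideal A) [𝔮.IsPrime], 𝔮 ≤ 𝔭 → ideal P φ 𝔭 ≤ 𝔮 → IsLogRegularAt P φ 𝔮)
    (hrank : n - Module.finrank ℤ (Submodule.span ℤ (faceMonoid P φ 𝔭 : Set (Fin n → ℤ))) ≤ 2) (hPQ : P ≤ Q)
    (hχ : ∀ p : P, χ (Multiplicative.ofAdd ⟨(p : Fin n → ℤ), hPQ p.2⟩) =
      algebraMap A C (φ (Multiplicative.ofAdd p)))
    (hgen : Algebra.adjoin A (Set.range χ) = ⊤)
    (hD : ∀ q ∈ Q, ∃ p ∈ P, q + p ∈ P)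
    (hK : ∀ a : A, algebraMap A C a = 0 → ∃ p : P, φ (Multiplicative.ofAdd p) * a = 0)
    (hΩ : ∀ (K : Type u) [Field K] (g : A →+* K), (∀ p : P, g (φ (Multiplicative.ofAdd p)) ≠ 0) →
      ∃ ω : C →+* K, ω.comp (algebraMap A C) = g)
    (hQfg : Q.FG) (hhQ : h ∈ Q)
    (hQh : ∀ w, w ∈ blowupChartMonoid Q {q : Q | (q : Fin n → ℤ) ∈ s} ⟨h, hhQ⟩ ↔
      ∃ g ∈ Submodule.span ℤ (faceMonoid P φ 𝔭 : Set (Fin n → ℤ)), ∃ m l : ℤ,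
        0 ≤ m ∧ 0 ≤ m + (c : ℤ) * l ∧ w = g + m • v + l • x)
    (hind : ∀ g ∈ Submodule.span ℤ (faceMonoid P φ 𝔭 : Set (Fin n → ℤ)), ∀ m l : ℤ,
      g + m • v + l • x = 0 → m = 0 ∧ l = 0)
    (hspan : ∀ w : Fin n → ℤ, ∃ g ∈ Submodule.span ℤ (faceMonoid P φ 𝔭 : Set (Fin n → ℤ)),
      ∃ m l : ℤ, w = g + m • v + l • x) :
    ∃ 𝔓h : Ideal (blowupAlgebra (Ideal.span ((fun q : Q => χ (Multiplicative.ofAdd q)) ''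
        {q : Q | (q : Fin n → ℤ) ∈ s})) (χ (Multiplicative.ofAdd ⟨h, hhQ⟩))), ∃ (_ : 𝔓h.IsPrime),
      𝔓h.comap (algebraMap A _) = 𝔭 ∧
      (∀ q : blowupChartMonoid Q {q : Q | (q : Fin n → ℤ) ∈ s} ⟨h, hhQ⟩,
        blowupChart Q χ {q : Q | (q : Fin n → ℤ) ∈ s} ⟨h, hhQ⟩ (Multiplicative.ofAdd q) ∈ 𝔓h ↔
          (q : Fin n → ℤ) ∉ Submodule.span ℤ (faceMonoid P φ 𝔭 : Set (Fin n → ℤ))) ∧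
      (∀ (𝔓 : Ideal C) [𝔓.IsPrime], 𝔓.comap (algebraMap A C) = 𝔭 →
        (∀ q : Q, (q : Fin n → ℤ) ∉ Submodule.span ℤ (faceMonoid P φ 𝔭 : Set (Fin n → ℤ)) →
          χ (Multiplicative.ofAdd q) ∈ 𝔓) → 𝔓h.comap (algebraMap C _) = 𝔓) ∧
      ¬ IsRegularLocalRing (Localization.AtPrime 𝔓h) ∧
      (∀ (𝔔 : Ideal (blowupAlgebra (Ideal.span ((fun q : Q => χ (Multiplicative.ofAdd q)) ''
          {q : Q | (q : Fin n → ℤ) ∈ s})) (χ (Multiplicative.ofAdd ⟨h, hhQ⟩)))) [𝔔.IsPrime],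
        𝔔.comap (algebraMap A _) = 𝔭 → 𝔔 ≠ 𝔓h → IsRegularLocalRing (Localization.AtPrime 𝔔)) ∧
      (∀ p : P, blowupChart Q χ {q : Q | (q : Fin n → ℤ) ∈ s} ⟨h, hhQ⟩ (Multiplicative.ofAdd
          ⟨(p : Fin n → ℤ), (hPQ.trans (le_blowupChartMonoid Q _ ⟨h, hhQ⟩)) p.2⟩) =
        algebraMap A _ (φ (Multiplicative.ofAdd p))) ∧
      Algebra.adjoin A (Set.range (blowupChart Q χ {q : Q | (q : Fin n → ℤ) ∈ s} ⟨h, hhQ⟩)) = ⊤ ∧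
      (∀ q ∈ blowupChartMonoid Q {q : Q | (q : Fin n → ℤ) ∈ s} ⟨h, hhQ⟩, ∃ p ∈ P, q + p ∈ P) ∧
      (∀ r : A, algebraMap A (blowupAlgebra (Ideal.span ((fun q : Q => χ (Multiplicative.ofAdd q)) ''
          {q : Q | (q : Fin n → ℤ) ∈ s})) (χ (Multiplicative.ofAdd ⟨h, hhQ⟩))) r = 0 →
        ∃ p : P, φ (Multiplicative.ofAdd p) * r = 0) ∧
      (∀ (K : Type u) [Field K] (g : A →+* K), (∀ p : P, g (φ (Multiplicative.ofAdd p)) ≠ 0) →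
        ∃ ω : blowupAlgebra (Ideal.span ((fun q : Q => χ (Multiplicative.ofAdd q)) ''
          {q : Q | (q : Fin n → ℤ) ∈ s})) (χ (Multiplicative.ofAdd ⟨h, hhQ⟩)) →+* K, ω.comp (algebraMap A _) = g) ∧
      (blowupChartMonoid Q {q : Q | (q : Fin n → ℤ) ∈ s} ⟨h, hhQ⟩).FG ∧
      (∀ w, w ∈ blowupChartMonoid Q {q : Q | (q : Fin n → ℤ) ∈ s} ⟨h, hhQ⟩ ↔
        ∃ g ∈ Submodule.span ℤ (faceMonoid P φ 𝔭 : Set (Fin n → ℤ)), ∃ m l : ℤ,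
          0 ≤ l ∧ ((c - 1 : ℕ) : ℤ) * l ≤ (c : ℤ) * m ∧ w = g + m • x + l • (v - x)) ∧
      (∀ g ∈ Submodule.span ℤ (faceMonoid P φ 𝔭 : Set (Fin n → ℤ)), ∀ m l : ℤ,
        g + m • x + l • (v - x) = 0 → m = 0 ∧ l = 0) ∧
      (∀ w : Fin n → ℤ, ∃ g ∈ Submodule.span ℤ (faceMonoid P φ 𝔭 : Set (Fin n → ℤ)),
        ∃ m l : ℤ, w = g + m • x + l • (v - x)) := by
  haveI : IsNoetherianRing (blowupAlgebra (Ideal.span ((fun q : Q => χ (Multiplicative.ofAdd q)) ''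
      {q : Q | (q : Fin n → ℤ) ∈ s})) (χ (Multiplicative.ofAdd ⟨h, hhQ⟩))) :=
    isNoetherianRing_blowupAlgebra_of_isNoetherianRing _ _
  -- the chart-algebra data of `C_h`
  obtain ⟨hgen₂, hD₂, hK₂, hΩ₂⟩ := tower_pack hPQ hχ hgen hD hK hΩ {q : Q | (q : Fin n → ℤ) ∈ s} ⟨h, hhQ⟩
  have hχ₂ := tower_chi hPQ hχ (le_blowupChartMonoid Q {q : Q | (q : Fin n → ℤ) ∈ s} ⟨h, hhQ⟩)
    (blowupChart_of_mem Q χ {q : Q | (q : Fin n → ℤ) ∈ s} ⟨h, hhQ⟩)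
  have hfg₂ : (blowupChartMonoid Q {q : Q | (q : Fin n → ℤ) ∈ s} ⟨h, hhQ⟩).FG :=
    blowupChartMonoid_fg hQfg (preimage_finite hs) ⟨h, hhQ⟩
  have hPQ₂ : P ≤ blowupChartMonoid Q {q : Q | (q : Fin n → ℤ) ∈ s} ⟨h, hhQ⟩ :=
    hPQ.trans (le_blowupChartMonoid Q _ ⟨h, hhQ⟩)
  have hS₂ := vertex_face (by omega : 1 ≤ c) hQh hind
  have hH₂ : ∀ q ∈ blowupChartMonoid Q {q : Q | (q : Fin n → ℤ) ∈ s} ⟨h, hhQ⟩, ∀ p ∈ P,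
      q + p ∈ Submodule.span ℤ (faceMonoid P φ 𝔭 : Set (Fin n → ℤ)) →
        q ∈ Submodule.span ℤ (faceMonoid P φ 𝔭 : Set (Fin n → ℤ)) :=
    fun q hq p hp hqp => hS₂ q hq p (hPQ₂ hp) hqp
  -- the fixed prime
  obtain ⟨𝔓h, h𝔓hprime, h𝔓hA, h𝔓hq, -, -⟩ :=
    exists_isPrime_comap_eq_forall_mem_iff hP hsat hreg hPQ₂ hχ₂ hgen₂ hD₂ hK₂ hS₂ hH₂
  haveI := h𝔓hprime
  have hq₂ : ∀ q : blowupChartMonoid Q {q : Q | (q : Fin n → ℤ) ∈ s} ⟨h, hhQ⟩,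
      (q : Fin n → ℤ) ∉ Submodule.span ℤ (faceMonoid P φ 𝔭 : Set (Fin n → ℤ)) →
        blowupChart Q χ {q : Q | (q : Fin n → ℤ) ∈ s} ⟨h, hhQ⟩ (Multiplicative.ofAdd q) ∈ 𝔓h :=
    fun q hq => (h𝔓hq q).2 hq
  -- memberships of the three monomials
  obtain ⟨⟨hvQ, hvL⟩, ⟨hxQ, hxL⟩, ⟨hyQ, hyL⟩⟩ := vertex_gens_mem hQh hind
  obtain ⟨hcone, hind', hspan'⟩ := cone_of_vertex (by omega : 1 ≤ c) hQh hind
  refine ⟨𝔓h, h𝔓hprime, h𝔓hA, h𝔓hq, ?_, ?_, ?_, hχ₂, hgen₂, hD₂, hK₂, hΩ₂, hfg₂, hcone, hind', ?_⟩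
  · -- over the old fixed prime
    intro 𝔓 _ h𝔓A h𝔓q
    haveI : (𝔓h.comap (algebraMap C _)).IsPrime := Ideal.IsPrime.comap _
    refine eq_of_comap_eq_of_forall_mem hPQ hχ hgen ?_ h𝔓A ?_ h𝔓q
    · rw [Ideal.comap_comap, ← IsScalarTower.algebraMap_eq]; exact h𝔓hA
    · intro q hq
      rw [Ideal.mem_comap, ← blowupChart_of_mem Q χ {q : Q | (q : Fin n → ℤ) ∈ s} ⟨h, hhQ⟩ q]
      exact hq₂ ⟨(q : Fin n → ℤ), le_blowupChartMonoid Q _ ⟨h, hhQ⟩ q.2⟩ hq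
  · -- singular at the fixed prime (stratum of any dimension)
    exact not_isRegularLocalRing_chart_fixedPrime_of_stratum hc hs hP hsat hreg hreg' hrank hPQ hχ hgen hD hK hΩ
      hQfg hhQ hQh hind hspan h𝔓hA hq₂
  · -- regular at every other prime over `𝔭`
    intro 𝔔 _ h𝔔A hne
    apply isRegularLocalRing_chart_of_not_mem hP hsat hspanP hPQ hχ hgen hD hK hΩ hreg hhQ hQh hind hspan 𝔔 h𝔔A
      hvQ hxQ hyQ
    by_contra hall
    push Not at hall
    obtain ⟨h1, h2, h3⟩ := hall
    apply hne
    refine eq_of_comap_eq_of_forall_mem hPQ₂ hχ₂ hgen₂ h𝔔A h𝔓hA (fun q hq => ?_) hq₂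
    -- every non-unit monomial is a multiple of one of the three
    obtain ⟨g, hg, hqg⟩ := VertexChartBlowup.exists_generator_sub_mem (by omega : 1 ≤ c) hQh hind q.2 hq
    have hgQ : g ∈ blowupChartMonoid Q {q : Q | (q : Fin n → ℤ) ∈ s} ⟨h, hhQ⟩ := by
      rcases hg with rfl | rfl | rfl <;> assumption
    have e1 : blowupChart Q χ {q : Q | (q : Fin n → ℤ) ∈ s} ⟨h, hhQ⟩ (Multiplicative.ofAdd q) =
        blowupChart Q χ {q : Q | (q : Fin n → ℤ) ∈ s} ⟨h, hhQ⟩ (Multiplicative.ofAdd ⟨g, hgQ⟩) *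
          blowupChart Q χ {q : Q | (q : Fin n → ℤ) ∈ s} ⟨h, hhQ⟩
            (Multiplicative.ofAdd ⟨(q : Fin n → ℤ) - g, hqg⟩) := by
      rw [← map_mul, ← ofAdd_add]
      congr 1
      apply Multiplicative.toAdd.injective
      apply Subtype.ext
      change (q : Fin n → ℤ) = g + ((q : Fin n → ℤ) - g)
      abel
    rw [e1]
    refine Ideal.mul_mem_right _ _ ?_
    rcases hg with rfl | rfl | rfl
    · exact h1
    · exact h2
    · exact h3
  · intro w
    obtain ⟨g, hg, m, l, rfl⟩ := hspan w
    exact hspan' _ ⟨g, hg, m, l, rfl⟩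

end Summit.ResolutionOfSingularities.ResolutionOfSingularities.Theorems.FRationalResolution.FixedStratumNextRound

end
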